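import Literature.NumberTheory.GaloisRepresentations.InducedGaloisRep
import Literature.NumberTheory.GaloisRepresentations.SymplecticMultiplier
import HarnessLib

/-!
# The induced representation of an essentially self-dual representation whose multiplier
# extends to the big group is essentially self-dual (symplectic/orthogonal with the same form type)

Topic `Literature/NumberTheory/GaloisRepresentations`.  Theorem-only file (no named fact, no new
notion): the classical observation behind the "twisted induction" constructions of Harris–Soudry–Taylor (theta lifts from `GL₂` over an imaginary
quadratic field to `GSp₄/ℚ` when the central character factors through the norm) and of
Barnet-Lamb–Gee–Geraghty–Taylor-style potential automorphy arguments: if `π : H → GL_n(R)`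
preserves a bilinear form `J₀` up to a multiplier `θ ∘ φ` which is the RESTRICTION of a character
`θ` of the big group `G ⊇ φ(H)` (finite index), then `Ind_H^G π` preserves the block-diagonal form
`diag(θ(rᵢ) J₀)ᵢ` (for the transversal `rᵢ` used to write `Ind` in matrix form) up to the
multiplier `θ`.  In particular (`n = 2`, `J₀` the standard alternating form, multiplier `det`):
**if `det ρ = θ|_{Γ_F}` for a character `θ` of `Γ_K`, then `Ind_{Γ_F}^{Γ_K} ρ` is symplectic with
multiplier `θ`** (`FramedGaloisRep.induce_isSymplecticWithMultiplier_of_det_eq`), in the tree's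
vocabulary `FramedGaloisRep.induce` (`InducedGaloisRep`) and `IsSymplecticWithMultiplier(Fun)`
(`SymplecticMultiplier`).

Proof (block level, `indMatrix_blockTranspose_mul_diagonal_mul`): with `M = Ind(π)(g)`,
block `(j, k)` of `Mᵀ 𝒥 M` is `∑ᵢ (M i j)ᵀ θ(rᵢ) J₀ (M i k)`; only the coset `i₀` of `g rⱼ`
contributes, `M i₀ k = 0` unless `k = j`, and for `k = j`, `rᵢ₀⁻¹ g rⱼ = φ b` gives
`π(b)ᵀ θ(rᵢ₀) J₀ π(b) = θ(rᵢ₀ φ b) J₀ = θ(g) θ(rⱼ) J₀`.  The flattened statements follow by pushing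
`Matrix.comp` / `Matrix.reindex` through products, transposes and scalars; the determinant of the
Gram matrix is `∏ᵢ θ(rᵢ)ⁿ det J₀` (`Matrix.det_blockDiagonal`).

## References

* J.-P. Serre, *Linear representations of finite groups*, GTM 42 (1977), §3.3 (matrix form of the
  induced representation). [SerreLinearRepresentations1977]
* M. Harris, D. Soudry, R. Taylor, *`l`-adic representations associated to modular forms over
  imaginary quadratic fields. I*, Invent. Math. 112 (1993), Introduction (induction to `GSp₄` when
  the central character factors through the norm).
* T. Barnet-Lamb, T. Gee, D. Geraghty, R. Taylor, *Potential automorphy and change of weight*,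
  Ann. of Math. 179 (2014), §2.1 (essentially self-dual pairs `(r, μ)`). [BarnetlambEtAl2014]
-/

noncomputable section

open Matrix Field Topology

namespace Literature.NumberTheory.GaloisRepresentations

universe u v

/-! ### Block level: the Gram matrix `diag(θ(rᵢ) • J₀)` -/

section Blocks

variable {H G R : Type*} [Group H] [Group G] [CommRing R] {ι : Type*} {n : Type*}

/-- A multiplicative character of a group takes unit values. [folklore] -/
theorem isUnit_monoidHom_apply_of_group (θ : G →* R) (g : G) : IsUnit (θ g) :=
  (θ.toHomUnits g).isUnit

variable [Fintype ι] [DecidableEq ι] [Fintype n] [DecidableEq n]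

/-- **The induced matrix preserves the block Gram matrix up to the multiplier `θ`** (block
level).  If `π(h)ᵀ J₀ π(h) = θ(φ h) • J₀` for all `h ∈ H` (the form `J₀` is preserved by `π` up
to the multiplier `θ ∘ φ`, `θ` a character of the BIG group), then for every `g ∈ G` the block
matrix `M = Ind(π)(g)` satisfies `Mᵀ 𝒥 M = θ(g) • 𝒥` with `𝒥 = diag(θ(rᵢ) J₀)` — block
transpose being `(Mᵀ)_{ij} = (M_{ji})ᵀ`. [folklore] -/
theorem indMatrix_blockTranspose_mul_diagonal_mul {φ : H →* G} (hφ : Function.Injective φ)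
    (π : H →* Matrix n n R) {r : ι → G}
    (hr : Function.Bijective fun i => (r i : G ⧸ φ.range)) (θ : G →* R) (J₀ : Matrix n n R)
    (hπ : ∀ h : H, (π h)ᵀ * J₀ * π h = θ (φ h) • J₀) (g : G) :
    (indMatrix φ π r g)ᵀ.map (·ᵀ) * Matrix.diagonal (fun i => θ (r i) • J₀) * indMatrix φ π r g =
      θ g • Matrix.diagonal (fun i => θ (r i) • J₀) := by
  refine Matrix.ext fun j k => ?_
  -- the coset of `g rⱼ`
  obtain ⟨i₀, hi₀⟩ := hr.2 ((g * r j : G) : G ⧸ φ.range)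
  have hmem : (r i₀)⁻¹ * g * r j ∈ φ.range := (inv_mul_mul_mem_range_iff φ r g i₀ j).2 hi₀
  obtain ⟨b, hb⟩ := hmem
  have hzero : ∀ i, i ≠ i₀ → indMatrix φ π r g i j = 0 := by
    intro i hi
    rw [indMatrix_apply]
    refine dotExtend_of_not_mem φ π fun h => hi (hr.1 ?_)
    exact ((inv_mul_mul_mem_range_iff φ r g i j).1 h).trans hi₀.symm
  rw [Matrix.mul_apply, Finset.sum_eq_single i₀]
  · -- the surviving term
    rw [Matrix.mul_apply, Finset.sum_eq_single i₀]
    · rw [Matrix.map_apply, transpose_apply, diagonal_apply, if_pos rfl, Matrix.smul_apply, diagonal_apply]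
      by_cases hjk : j = k
      · subst hjk
        rw [if_pos rfl, indMatrix_apply, ← hb, dotExtend_apply_map hφ, Matrix.mul_smul,
          Matrix.smul_mul, hπ b, smul_smul, smul_smul, ← map_mul, ← map_mul, hb]
        congr 1
        congr 1
        group
      · rw [if_neg hjk, smul_zero]
        have hk : indMatrix φ π r g i₀ k = 0 := by
          rw [indMatrix_apply]
          refine dotExtend_of_not_mem φ π fun h => hjk (hr.1 ?_)
          have h1 := (inv_mul_mul_mem_range_iff φ r g i₀ k).1 h
          -- cosets of `g rⱼ` and `g r_k` coincide, hence those of `rⱼ`, `r_k`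
          have h2 : ((g * r j : G) : G ⧸ φ.range) = (g * r k : G) := hi₀.symm.trans h1
          change (r j : G ⧸ φ.range) = (r k : G)
          rw [QuotientGroup.eq] at h2 ⊢
          simpa [mul_assoc] using h2
        rw [hk, Matrix.mul_zero]
    · intro i _ hi
      rw [Matrix.map_apply, transpose_apply, diagonal_apply, if_neg hi, Matrix.mul_zero]
    · intro h
      exact absurd (Finset.mem_univ i₀) h
  · intro i _ hi
    rw [Matrix.mul_apply, Finset.sum_eq_single i]
    · rw [Matrix.map_apply, transpose_apply, hzero i hi, transpose_zero]
      simp only [Matrix.zero_mul]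
    · intro i' _ hi'
      rw [diagonal_apply, if_neg hi', Matrix.mul_zero]
    · intro h
      exact absurd (Finset.mem_univ i) h
  · intro h
    exact absurd (Finset.mem_univ i₀) h

omit [Fintype ι] [Fintype n] [DecidableEq n] in
/-- The block Gram matrix is block-symmetric/antisymmetric with `J₀`: if `J₀ᵀ = ε • J₀` then the
block transpose of `𝒥` is `ε • 𝒥`. [folklore] -/
theorem diagonal_smul_transpose_map_transpose (θ : G →* R) (r : ι → G) {J₀ : Matrix n n R} {ε : R}
    (hJ : J₀ᵀ = ε • J₀) : (Matrix.diagonal (fun i => θ (r i) • J₀))ᵀ.map (·ᵀ) = ε • Matrix.diagonal (fun i => θ (r i) • J₀) := by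
  refine Matrix.ext fun i j => ?_
  rw [Matrix.map_apply, transpose_apply, diagonal_apply, Matrix.smul_apply, diagonal_apply]
  by_cases hij : i = j
  · subst hij
    rw [if_pos rfl, transpose_smul, hJ, smul_comm]
  · rw [if_neg (Ne.symm hij), if_neg hij, transpose_zero, smul_zero]

omit [Fintype ι] [Fintype n] [DecidableEq n] in
/-- `Matrix.comp` of a block-diagonal matrix of blocks is Mathlib's `blockDiagonal`, reindexed by
swapping the factors. [folklore] -/
theorem comp_diagonal_eq_reindex_blockDiagonal (f : ι → Matrix n n R) :
    Matrix.comp ι ι n n R (Matrix.diagonal f) =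
      Matrix.reindex (Equiv.prodComm n ι) (Equiv.prodComm n ι) (Matrix.blockDiagonal f) := by
  ext ⟨i, a⟩ ⟨j, b⟩
  simp only [comp_apply, reindex_apply, submatrix_apply, Equiv.prodComm_symm,
    Equiv.prodComm_apply, Prod.swap_prod_mk, blockDiagonal_apply', diagonal_apply]
  split_ifs with h
  · subst h; rfl
  · rfl

/-- **Determinant of the block Gram matrix**: `det 𝒥 = ∏ᵢ θ(rᵢ)ⁿ det J₀`; in particular it is
a unit as soon as `det J₀` is. [folklore] -/
theorem isUnit_det_comp_diagonal_smul (θ : G →* R) (r : ι → G) {J₀ : Matrix n n R}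
    (hJ : IsUnit J₀.det) : IsUnit (Matrix.comp ι ι n n R (Matrix.diagonal (fun i => θ (r i) • J₀))).det := by
  rw [comp_diagonal_eq_reindex_blockDiagonal, det_reindex_self, det_blockDiagonal]
  refine IsUnit.prod_univ_iff.2 fun i => ?_
  rw [det_smul]
  exact ((isUnit_monoidHom_apply_of_group θ (r i)).pow _).mul hJ

end Blocks

/-! ### Framed continuous representations -/

section Framed

variable {H : Type*} {G : Type*} [Group H] [TopologicalSpace H] [Group G] [TopologicalSpace G]
  [IsTopologicalGroup G] {A : Type*} [CommRing A] [TopologicalSpace A] {n m : ℕ}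
  {ι : Type*} [Fintype ι] [DecidableEq ι]

namespace FramedRep

omit [TopologicalSpace A] [Fintype ι] [DecidableEq ι] in
/-- `comp` commutes with scalars. [folklore] -/
theorem comp_smul_blocks (c : A) (M : Matrix ι ι (Matrix (Fin n) (Fin n) A)) :
    Matrix.comp ι ι (Fin n) (Fin n) A (c • M) = c • Matrix.comp ι ι (Fin n) (Fin n) A M := rfl

/-- **`Ind(ρ)` preserves the flattened Gram matrix up to the multiplier `θ`**:
`Ind(ρ)(g)ᵀ 𝒥' Ind(ρ)(g) = θ(g) • 𝒥'` whenever `ρ(h)ᵀ J₀ ρ(h) = θ(φ h) • J₀` on `H`. [folklore] -/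
theorem induce_transpose_mul_gram_mul {φ : H →* G} (hφ : IsOpenEmbedding φ) {r : ι → G}
    (hr : Function.Bijective fun i => (r i : G ⧸ φ.range)) (e : ι × Fin n ≃ Fin m)
    (ρ : FramedRep H A n) (θ : G →* A) (J₀ : Matrix (Fin n) (Fin n) A)
    (hρ : ∀ h : H, ((ρ h : GL (Fin n) A) : Matrix (Fin n) (Fin n) A)ᵀ * J₀ * (ρ h : GL (Fin n) A) =
      θ (φ h) • J₀) (g : G) :
    ((induce φ hφ r hr e ρ g : GL (Fin m) A) : Matrix (Fin m) (Fin m) A)ᵀ * Matrix.reindex e e (Matrix.comp ι ι (Fin n) (Fin n) A (Matrix.diagonal (fun i => θ (r i) • J₀))) *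
        ((induce φ hφ r hr e ρ g : GL (Fin m) A) : Matrix (Fin m) (Fin m) A) =
      θ g • Matrix.reindex e e (Matrix.comp ι ι (Fin n) (Fin n) A (Matrix.diagonal (fun i => θ (r i) • J₀))) := by
  have key := indMatrix_blockTranspose_mul_diagonal_mul hφ.injective ρ.toMatrixHom hr θ J₀
    (fun h => by simpa only [toMatrixHom_apply] using hρ h) g
  rw [induce_apply_coe, indFlatHom_apply_eq_reindex, transpose_reindex,
    transpose_comp, reindex_apply, reindex_apply, reindex_apply, submatrix_mul_equiv,
    submatrix_mul_equiv, ← compRingEquiv_apply, ← compRingEquiv_apply, ← compRingEquiv_apply,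
    ← map_mul, ← map_mul, key, compRingEquiv_apply, comp_smul_blocks, submatrix_smul]
  rfl

omit [TopologicalSpace G] [IsTopologicalGroup G] [TopologicalSpace A] [Fintype ι] in
/-- The flattened Gram matrix is antisymmetric when `J₀` is. [folklore] -/
theorem gram_transpose_of_transpose_eq_neg (θ : G →* A) (r : ι → G) (e : ι × Fin n ≃ Fin m)
    {J₀ : Matrix (Fin n) (Fin n) A} (hJ : J₀ᵀ = -J₀) :
    (Matrix.reindex e e (Matrix.comp ι ι (Fin n) (Fin n) A (Matrix.diagonal (fun i => θ (r i) • J₀))))ᵀ = -Matrix.reindex e e (Matrix.comp ι ι (Fin n) (Fin n) A (Matrix.diagonal (fun i => θ (r i) • J₀))) := by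
  have h := diagonal_smul_transpose_map_transpose θ r (ε := -1) (by rw [hJ, neg_one_smul])
  rw [transpose_reindex, transpose_comp, h, comp_smul_blocks, neg_one_smul, reindex_apply, reindex_apply,
    submatrix_neg]
  rfl

omit [TopologicalSpace G] [IsTopologicalGroup G] [TopologicalSpace A] in
/-- The flattened Gram matrix is non-degenerate when `J₀` is. [folklore] -/
theorem isUnit_det_gram (θ : G →* A) (r : ι → G) (e : ι × Fin n ≃ Fin m)
    {J₀ : Matrix (Fin n) (Fin n) A} (hJ : IsUnit J₀.det) : IsUnit (Matrix.reindex e e (Matrix.comp ι ι (Fin n) (Fin n) A (Matrix.diagonal (fun i => θ (r i) • J₀)))).det := by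
  rw [det_reindex_self]
  exact isUnit_det_comp_diagonal_smul θ r hJ

end FramedRep

end Framed

/-! ### Galois representations: `Ind_{Γ_F}^{Γ_K} ρ` is symplectic with multiplier `θ` -/

section Galois

variable (K : Type u) {F : Type v} [Field K] [Field F] [Algebra K F] [CharZero K]
  [FiniteDimensional K F] {A : Type*} [CommRing A] [TopologicalSpace A] {n d : ℕ}

namespace FramedGaloisRep

/-- **Induction of a form-preserving representation with descending multiplier.**  Let `F/K`
be a finite extension of fields of characteristic `0` of degree `d`, `ρ : Γ_F →ₜ* GL_n(A)`,
`θ : Γ_K →* A` a multiplicative character and `J₀` an invertible antisymmetric matrix with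
`ρ(σ)ᵀ J₀ ρ(σ) = θ(res σ) • J₀` for all `σ ∈ Γ_F`.  Then `Ind_{Γ_F}^{Γ_K} ρ`
(`FramedGaloisRep.induce`) is symplectic with multiplier (function) `θ`: the Gram matrix is
`diag(θ(r₁) J₀, …, θ(r_d) J₀)` in the frame of `induce`. [folklore] -/
theorem induce_isSymplecticWithMultiplierFun (hd : Module.finrank K F = d)
    (ρ : FramedGaloisRep F A n) (θ : absoluteGaloisGroup K →* A) {J₀ : Matrix (Fin n) (Fin n) A}
    (hJT : J₀ᵀ = -J₀) (hJd : IsUnit J₀.det)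
    (hρ : ∀ σ : absoluteGaloisGroup F,
      ((ρ σ : GL (Fin n) A) : Matrix (Fin n) (Fin n) A)ᵀ * J₀ * (ρ σ : GL (Fin n) A) =
        θ (absGaloisRestrict K F σ) • J₀) :
    (ρ.induce K hd).IsSymplecticWithMultiplierFun θ := by
  refine ⟨Matrix.reindex finProdFinEquiv finProdFinEquiv (Matrix.comp (Fin d) (Fin d) (Fin n) (Fin n) A
      (Matrix.diagonal (fun i => θ (absGaloisCosetRep K F hd i) • J₀))),
    FramedRep.gram_transpose_of_transpose_eq_neg θ _ _ hJT,
    FramedRep.isUnit_det_gram θ _ _ hJd, fun g => ?_⟩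
  rw [induce_def]
  exact FramedRep.induce_transpose_mul_gram_mul (isOpenEmbedding_absGaloisRestrict K F)
    (absGaloisCosetRep_bijective K F hd) finProdFinEquiv ρ θ J₀ hρ g

omit [TopologicalSpace A] in
/-- In rank `2` every representation preserves the standard alternating form up to its
determinant: `ρ(σ)ᵀ J ρ(σ) = det ρ(σ) • J`, `J = !![0, 1; -1, 0]`. [folklore] -/
theorem transpose_mul_stdJ_mul_two (M : Matrix (Fin 2) (Fin 2) A) :
    Mᵀ * !![0, 1; -1, 0] * M = M.det • !![0, 1; -1, 0] := by
  ext i j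
  fin_cases i <;> fin_cases j <;>
    simp [Matrix.det_fin_two, Matrix.mul_apply, Fin.sum_univ_two, Matrix.transpose_apply] <;> ring

/-- **Twisted induction polarises.**  Let `F/K` be a finite extension of fields of characteristic
`0` of degree `d` and `ρ : Γ_F →ₜ* GL₂(A)` a rank-two framed Galois representation whose
determinant DESCENDS to `K`: `det ρ = θ|_{Γ_F}` (`FramedRep.det ρ = θ.comp (absGaloisRestrict K F)`)
for a continuous character `θ : Γ_K →ₜ* Aˣ`.  Then `Ind_{Γ_F}^{Γ_K} ρ : Γ_K →ₜ* GL_{2d}(A)` is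
symplectic with multiplier `θ` (`IsSymplecticWithMultiplier`): it lands in `GSp_{2d}` with
similitude character `θ`.  (For `K` totally real, `F` CM and `θ` totally odd this is the odd
essential self-duality that potential automorphy theorems over totally real fields require.)
[folklore] -/
theorem induce_isSymplecticWithMultiplier_of_det_eq [IsTopologicalRing A]
    (hd : Module.finrank K F = d) (ρ : FramedGaloisRep F A 2)
    (θ : absoluteGaloisGroup K →ₜ* Aˣ)
    (hdet : FramedRep.det ρ = θ.comp (absGaloisRestrict K F)) :
    (ρ.induce K hd).IsSymplecticWithMultiplier θ := by
  have hθ : ∀ σ : absoluteGaloisGroup F,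
      ((ρ σ : GL (Fin 2) A) : Matrix (Fin 2) (Fin 2) A).det = ((θ (absGaloisRestrict K F σ) : Aˣ) : A) := by
    intro σ
    have h := congrArg (fun f : absoluteGaloisGroup F →ₜ* Aˣ => ((f σ : Aˣ) : A)) hdet
    simpa [FramedRep.det_apply, Matrix.GeneralLinearGroup.val_det_apply] using h
  refine induce_isSymplecticWithMultiplierFun K hd ρ ((Units.coeHom A).comp θ.toMonoidHom)
    (J₀ := !![0, 1; -1, 0]) ?_ ?_ fun σ => ?_
  · ext i j; fin_cases i <;> fin_cases j <;> simp
  · simp [Matrix.det_fin_two]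
  · rw [transpose_mul_stdJ_mul_two, hθ σ]
    rfl

end FramedGaloisRep

end Galois

end Literature.NumberTheory.GaloisRepresentations

end
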